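import Summits.AtomisticToContinuum.Crystallization.Theorems.ChartedZeroExcessLayeredLatticeLiouvilleZZZYRCXQ

/-!
# ChartedZeroExcessLayeredLatticeLiouville · ZZZYRCXR — THE θ⁰ KERNEL UNDER «APERIODIC-COVER», §1: THE IN-WINDOW ASSEMBLY
(decomp-a2c hand-1 g55; target stmt-AtomisticToContinuum-26636 JS-D near reader; critic r1864 (A)(4) «kernel variant over a finite non-periodic
window»,
r1867 (R1) H₀ := 5, (R4) RCXR; memo HOME/decomp-a2c-hand-1/g55/memo/RCXR-DESIGN-g55.md §1)

θ_in(ω) needs no new kernel: for a window type ω with letters `win` (length `2H₀+1`) the period-12 extension `w := win ++ [0]` (`12 ∣ 612`) with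
base residue `H₀` puts the window on layers `0 … 2H₀`, so the landed kernel reads exactly the window letters on in-window chords; the count box
takes `MB := H₀`.  What changes is ONLY the assembly's completeness clause: RCXP's `hMBb : hi < 6(MB+1)²` (which put every ideal-near site in
the layer box) is gone, so completeness is asserted for based pairs IN THE LAYER WINDOW `|Δm| ≤ MB`, and the chords' own far layers are certified
in the window by a decided Boolean.
§1 `layersWithin mX MB cs` (Bool: every chord's far layer within `MB` of the base) + soundness; `inBoxγ_of_n9W_le` (the in-plane box from `hGB`
alone); ★ `residue_completeW`; ★★ `kernelSlabSoundW_of_slabs` — conclusion = the four clauses of `KernelSlabSound` with the completeness clause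
restricted to `|x.2.2 − x.1.2| ≤ MB` (stated as an explicit conjunction; lens-2's 5c contract wraps it); ★★ `kernelSlabSoundW_of_residue` — the
same for ONE residue (`residueData/residueTR/residueTN`): the shape a window type needs (centre layer only).  §2–§3 (θ_out: letter-override
kernel, σ-copies, exact sup) follow the 5c contract (memo §2–§4).  Imports RCXQ; 0 sorry.  All `[folklore]`.
-/

namespace Summit.AtomisticToContinuum.Crystallization.Theorems.ChartedZeroExcessLayeredLatticeLiouville.ThetaKernel

open scoped BigOperators

/-! ## §1 the in-window assembly -/

/-- DECIDED SIDE CONDITION of a window slab: every chord's far site (last code) has shifted layer within `MB` of the shifted base layer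
`600 + mX`. -/
def layersWithin (mX MB : ℕ) (cs : List (List ℕ)) : Bool :=
  cs.all fun c => Nat.ble (600 + mX) (lastD c 0 % 1201 + MB) && Nat.ble (lastD c 0 % 1201) (600 + mX + MB)

/-- soundness of `layersWithin`: the decoded far layer is within `MB` of `mX`. [folklore] -/
theorem abs_layer_le_of_layersWithin {mX MB : ℕ} {cs : List (List ℕ)} (h : layersWithin mX MB cs = true) :
    ∀ c ∈ cs, |(decodeChord mX c).1.2.2 - (mX : ℤ)| ≤ MB := by
  intro c hc
  unfold layersWithin at h
  have hc' := List.all_eq_true.mp h c hc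
  rw [Bool.and_eq_true, Nat.ble_eq, Nat.ble_eq] at hc'
  have hY : (decodeChord mX c).1.2.2 = ((lastD c 0 % 1201 : ℕ) : ℤ) - 600 := rfl
  rw [hY, abs_le]
  constructor <;> push_cast <;> omega

/-- the IN-PLANE box from `hGB` alone: a site ideal-near the based site has `|γ₀|, |γ₁| ≤ GB` (no layer condition needed). [folklore] -/
theorem inBoxγ_of_n9W_le {w : List ℕ} (hw2 : ∀ n ∈ w, n ≤ 2) {mX GB : ℕ} {hi : ℤ} {y : Cell 2 × ℤ}
    (h9 : n9W (wordZ w) (((0 : Cell 2), (mX : ℤ)), y) ≤ hi) (hGB : 4 * hi < 3 * (3 * (GB : ℤ) + 1) ^ 2) :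
    |y.1 0| ≤ GB ∧ |y.1 1| ≤ GB := by
  have hb := wordZ_bounds hw2
  have h1 := regW_bounds hb y.2
  have h2 := regW_bounds hb (mX : ℤ)
  rw [n9W_based] at h9
  set d : ℤ := regW (wordZ w) y.2 - regW (wordZ w) mX with hd
  have hnn : 0 ≤ (3 * y.1 0 + d) * (3 * y.1 0 + d) + (3 * y.1 0 + d) * (3 * y.1 1 + d) + (3 * y.1 1 + d) * (3 * y.1 1 + d) +
      6 * (y.2 - mX) * (y.2 - mX) := by
    nlinarith [sq_nonneg (2 * (3 * y.1 0 + d) + (3 * y.1 1 + d)), sq_nonneg (3 * y.1 1 + d), sq_nonneg (y.2 - mX)]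
  have hhi : 0 ≤ hi := hnn.trans h9
  have hMB' : hi < 6 * (((hi.toNat : ℕ) : ℤ) + 1) ^ 2 := by rw [Int.toNat_of_nonneg hhi]; nlinarith
  obtain ⟨a0, a1, -⟩ := inBox_of_n9_le (y.1 0) (y.1 1) (y.2 - mX) d hi GB hi.toNat (abs_le.mpr ⟨by linarith, by linarith⟩) h9 hGB hMB'
  exact ⟨a0, a1⟩

section Residue

variable {w : List ℕ} {P9 E mX GB MB : ℕ} {cuts : List ℕ} {t0 : ℕ → PT} {cs : ℕ → List (List ℕ)} {T : ℕ → List (ℕ × ℕ × ℕ)}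

/-- ★★ COMPLETENESS OF ONE RESIDUE, WINDOW FORM: every site `y` IN THE LAYER WINDOW `|y.2 − mX| ≤ MB` with `κ₀ < n9((0,mX), y) ≤ κ_S` is the far
site of a chord decoded from some slab of the residue (the chords' far layers are within `MB` of the base by the decided `layersWithin`). [folklore] -/
theorem residue_completeW (hw2 : ∀ n ∈ w, n ≤ 2) (hp : w.length ∣ 612) (hmX : mX < 601) (hMB : MB ≤ 600)
    (hlen : 2 ≤ cuts.length) (hsort : cuts.Pairwise (· < ·))
    (hGB : 4 * (cuts.getD (cuts.length - 1) 0 : ℤ) < 3 * (3 * (GB : ℤ) + 1) ^ 2)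
    (hslab : ∀ s, s + 1 < cuts.length → slabAcc w P9 E mX (cuts.getD s 0) (cuts.getD (s + 1) 0) (t0 s) (cs s) = some (T s))
    (hstrict : ∀ s, s + 1 < cuts.length → lastCodesStrict (cs s) = true)
    (hcount : ∀ s, s + 1 < cuts.length → (cs s).length = (countWins w mX GB MB cuts).getD s 0)
    (hlay : ∀ s, s + 1 < cuts.length → layersWithin mX MB (cs s) = true)
    (y : Cell 2 × ℤ) (hym : |y.2 - mX| ≤ MB) (hlo : (cuts.getD 0 0 : ℤ) < n9W (wordZ w) (((0 : Cell 2), (mX : ℤ)), y))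
    (hhi : n9W (wordZ w) (((0 : Cell 2), (mX : ℤ)), y) ≤ cuts.getD (cuts.length - 1) 0) :
    ∃ s, s + 1 < cuts.length ∧ ∃ c ∈ cs s, (decodeChord mX c).1 = (((0 : Cell 2), (mX : ℤ)), y) := by
  have hw := regN_le_two hw2 w.length
  obtain ⟨κ, rest, hcr⟩ : ∃ κ rest, cuts = κ :: rest := by
    cases cuts with
    | nil => simp at hlen
    | cons κ rest => exact ⟨κ, rest, rfl⟩
  have hne : cuts ≠ [] := by rw [hcr]; exact List.cons_ne_nil κ rest
  have hlast : cuts.getLast hne = cuts.getD (cuts.length - 1) 0 := by rw [List.getLast_eq_getElem, List.getD_eq_getElem]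
  have hhead : cuts.getD 0 0 = κ := by rw [hcr]; rfl
  -- locate a site of the residue window in some slab window
  have locate : ∀ z : Cell 2 × ℤ, |z.2 - mX| ≤ MB → (cuts.getD 0 0 : ℤ) < n9W (wordZ w) (((0 : Cell 2), (mX : ℤ)), z) →
      n9W (wordZ w) (((0 : Cell 2), (mX : ℤ)), z) ≤ cuts.getD (cuts.length - 1) 0 →
      (|z.1 0| ≤ GB ∧ |z.1 1| ≤ GB ∧ |z.2 - mX| ≤ MB) ∧ ∃ s, s + 1 < cuts.length ∧
        slabIdx cuts (u9N w mX GB MB (z.1 0 + GB).toNat (z.1 1 + GB).toNat (z.2 - mX + MB).toNat) = some s ∧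
        (cuts.getD s 0 : ℤ) < n9W (wordZ w) (((0 : Cell 2), (mX : ℤ)), z) ∧ n9W (wordZ w) (((0 : Cell 2), (mX : ℤ)), z) ≤ cuts.getD (s + 1) 0 := by
    intro z hzm hzlo hzhi
    have hbox : |z.1 0| ≤ GB ∧ |z.1 1| ≤ GB ∧ |z.2 - mX| ≤ MB := ⟨(inBoxγ_of_n9W_le hw2 hzhi hGB).1, (inBoxγ_of_n9W_le hw2 hzhi hGB).2, hzm⟩
    have hu := u9N_offs hw2 hp hMB hbox.1 hbox.2.1 hbox.2.2
    set u := u9N w mX GB MB (z.1 0 + GB).toNat (z.1 1 + GB).toNat (z.2 - mX + MB).toNat with hudef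
    have hκ : κ < u := by
      have : (κ : ℤ) < u := by rw [hu, ← hhead]; exact hzlo
      exact_mod_cast this
    have hL : u ≤ (κ :: rest).getLast (List.cons_ne_nil κ rest) := by
      have h' : u ≤ cuts.getLast hne := by
        have : (u : ℤ) ≤ cuts.getD (cuts.length - 1) 0 := by rw [hu]; exact hzhi
        rw [hlast]; exact_mod_cast this
      simpa [hcr] using h'
    obtain ⟨s, hs⟩ := slabIdx_exists rest κ u hκ hL
    rw [← hcr] at hs
    obtain ⟨hs1, hslo, hshi⟩ := slabIdx_some cuts u s hs
    refine ⟨hbox, s, hs1, hs, ?_, ?_⟩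
    · rw [← hu]; exact_mod_cast hslo
    · rw [← hu]; exact_mod_cast hshi
  obtain ⟨hboxy, s, hs1, hsy, -, -⟩ := locate y hym hlo hhi
  refine ⟨s, hs1, ?_⟩
  -- the chords of slab `s`: far sites distinct, all in the window's site set
  obtain ⟨H1, -, -⟩ := slabAcc_sound w P9 E mX hw hmX _ _ (t0 s) (cs s) (T s) (hslab s hs1)
  have hY : ∀ c, (decodeChord mX c).1.2 = siteN (dec3 (lastD c 0)) := fun c => rfl
  have hnd : ((cs s).map fun c => (decodeChord mX c).1.2).Nodup := by
    have key : ((cs s).map fun c => (decodeChord mX c).1.2) = ((cs s).map fun c => lastD c 0).map fun y => siteN (dec3 y) := by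
      rw [List.map_map]; rfl
    rw [key]
    exact (nodup_lastCodes_of_strict (hstrict s hs1)).map_on fun a _ b _ hab => dec3_inj (siteN_inj hab)
  have hin : ∀ c ∈ cs s, (decodeChord mX c).1.2 ∈ windowSites w mX GB MB cuts s := by
    intro c hc
    obtain ⟨hclo, hchi, -⟩ := H1 c hc
    rw [← n9W_decodeChord_fst hp] at hclo hchi
    have hfst : (decodeChord mX c).1 = (((0 : Cell 2), (mX : ℤ)), (decodeChord mX c).1.2) := rfl
    rw [hfst] at hclo hchi
    have hzlo : (cuts.getD 0 0 : ℤ) < n9W (wordZ w) (((0 : Cell 2), (mX : ℤ)), (decodeChord mX c).1.2) :=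
      lt_of_le_of_lt (by exact_mod_cast getD_mono_of_sorted hsort (Nat.zero_le s) (by omega)) hclo
    have hzhi : n9W (wordZ w) (((0 : Cell 2), (mX : ℤ)), (decodeChord mX c).1.2) ≤ cuts.getD (cuts.length - 1) 0 :=
      hchi.trans (by exact_mod_cast getD_mono_of_sorted hsort (by omega) (by omega))
    obtain ⟨hboxc, s', hs1', hs', -, -⟩ := locate _ (abs_layer_le_of_layersWithin (hlay s hs1) c hc) hzlo hzhi
    have hu := u9N_offs hw2 hp hMB hboxc.1 hboxc.2.1 hboxc.2.2
    have heq : s' = s := by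
      refine slabIdx_eq_of_mem_window hsort hs1 ?_ ?_ hs'
      · have : (cuts.getD s 0 : ℤ) < _ := hclo
        rw [← hu] at this; exact_mod_cast this
      · have : _ ≤ (cuts.getD (s + 1) 0 : ℤ) := hchi
        rw [← hu] at this; exact_mod_cast this
    rw [heq] at hs'
    exact mem_windowSites hboxc.1 hboxc.2.1 hboxc.2.2 hs'
  have hcard : (windowSites w mX GB MB cuts s).card ≤ (cs s).length := by
    rw [hcount s hs1]; exact card_windowSites_le w mX GB MB cuts hs1
  obtain ⟨c, hc, hcy⟩ := cover_of_card_le_map (cs s) (fun c => (decodeChord mX c).1.2) _ hnd hin hcard y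
    (mem_windowSites hboxy.1 hboxy.2.1 hboxy.2.2 hsy)
  exact ⟨c, hc, Prod.ext rfl hcy⟩

end Residue

/-- ★★★ THE ASSEMBLY, WINDOW FORM: as RCXP's `kernelSlabSound_of_slabs` but the count box has `MB := the layer window` (no `hi < 6(MB+1)²`), every
slab's chords have far layers within `MB` (decided `layersWithin`), and COMPLETENESS is asserted for the based pairs IN THE LAYER WINDOW only
(`|x.2.2 − x.1.2| ≤ MB`); validity, distinctness and the tables are the three other clauses of `KernelSlabSound` verbatim (for a window type ω:
`w := win ++ [0]`, `|w| = 12`, base residue `H₀`, `MB := H₀` — memo RCXR-DESIGN-g55 §1). [folklore] -/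
theorem kernelSlabSoundW_of_slabs (w : List ℕ) (P9 E GB MB lo hi : ℕ) (cuts : ℕ → List ℕ) (t0 : ℕ → ℕ → PT)
    (cs : ℕ → ℕ → List (List ℕ)) (T : ℕ → ℕ → List (ℕ × ℕ × ℕ))
    (hw2 : ∀ n ∈ w, n ≤ 2) (hp : w.length ∣ 612) (hp1 : w.length ≤ 601) (hP9 : P9 ≤ 2000000) (hMB : MB ≤ 600) (hhi : hi < 2160000)
    (hGB : 4 * hi < 3 * (3 * GB + 1) ^ 2)
    (hcuts : ∀ r < w.length, 2 ≤ (cuts r).length ∧ (cuts r).Pairwise (· < ·) ∧ (cuts r).getD 0 0 = lo ∧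
      (cuts r).getD ((cuts r).length - 1) 0 = hi)
    (hslab : ∀ r < w.length, ∀ s, s + 1 < (cuts r).length →
      slabAcc w P9 E r ((cuts r).getD s 0) ((cuts r).getD (s + 1) 0) (t0 r s) (cs r s) = some (T r s) ∧
      lastCodesStrict (cs r s) = true ∧ (cs r s).length = (countWins w r GB MB (cuts r)).getD s 0 ∧ layersWithin r MB (cs r s) = true) :
    (∀ c ∈ slabData w.length cuts cs, c.1.1.1 = 0 ∧ 0 ≤ c.1.1.2 ∧ c.1.1.2 < ((wordZ w).length : ℤ) ∧ (lo : ℤ) < n9W (wordZ w) c.1 ∧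
        n9W (wordZ w) c.1 ≤ hi ∧ ∀ i < chordNp c, 0 < n9W (wordZ w) (chordPiece c i) ∧ n9W (wordZ w) (chordPiece c i) ≤ P9) ∧
      ((slabData w.length cuts cs).map (·.1)).Nodup ∧
      (∀ x : (Cell 2 × ℤ) × (Cell 2 × ℤ), x.1.1 = 0 → 0 ≤ x.1.2 → x.1.2 < ((wordZ w).length : ℤ) → |x.2.2 - x.1.2| ≤ MB →
        (lo : ℤ) < n9W (wordZ w) x → n9W (wordZ w) x ≤ hi → ∃ c ∈ slabData w.length cuts cs, c.1 = x) ∧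
      ∀ k, thetaR0 (wordZ w) (slabData w.length cuts cs) k ≤ (slabTR w.length cuts T k : ℝ) / 2 ^ E ∧
        thetaN0 (wordZ w) (slabData w.length cuts cs) k ≤ (slabTN w.length cuts T k : ℝ) / 2 ^ E := by
  have hw := regN_le_two hw2 w.length
  have hGBz : 4 * (hi : ℤ) < 3 * (3 * (GB : ℤ) + 1) ^ 2 := by exact_mod_cast hGB
  -- per slab: the window sits inside `(lo, hi]`, no chord is empty
  have hwin : ∀ r < w.length, ∀ s, s + 1 < (cuts r).length →
      (lo : ℤ) ≤ ((cuts r).getD s 0 : ℤ) ∧ (((cuts r).getD (s + 1) 0 : ℕ) : ℤ) ≤ (hi : ℤ) := by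
    intro r hr s hs
    obtain ⟨-, hsort, h0, hL⟩ := hcuts r hr
    constructor
    · rw [← h0]; exact_mod_cast getD_mono_of_sorted hsort (Nat.zero_le s) (by omega)
    · rw [← hL]; exact_mod_cast getD_mono_of_sorted hsort (by omega) (by omega)
  have hne : ∀ r < w.length, ∀ s, s + 1 < (cuts r).length → ∀ c ∈ cs r s, c ≠ [] := by
    intro r hr s hs c hc
    obtain ⟨H1, -, -⟩ := slabAcc_sound w P9 E r hw (by omega) _ _ (t0 r s) (cs r s) (T r s) (hslab r hr s hs).1
    have hhi' : (((cuts r).getD (s + 1) 0 : ℕ) : ℤ) < 2160000 := lt_of_le_of_lt (hwin r hr s hs).2 (by exact_mod_cast hhi)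
    exact ne_nil_of_window hhi' (H1 c hc).2.1
  -- membership in the data
  have hmem : ∀ c' ∈ slabData w.length cuts cs, ∃ r, r < w.length ∧ ∃ s, s + 1 < (cuts r).length ∧ c' ∈ (cs r s).map (decodeChord r) := by
    intro c' hc'
    unfold slabData at hc'
    obtain ⟨r, hr, hc'⟩ := List.mem_flatMap.mp hc'
    obtain ⟨s, hs, hc'⟩ := List.mem_flatMap.mp hc'
    rw [List.mem_range] at hr hs
    exact ⟨r, hr, s, by omega, hc'⟩
  refine ⟨fun c' hc' => ?_, ?_, fun x hx0 hxm hxp hxMB hxlo hxhi => ?_, fun k => ?_⟩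
  · -- per chord
    obtain ⟨r, hr, s, hs, hc'⟩ := hmem c' hc'
    obtain ⟨h1, h2, h3, h4, h5, h6⟩ := slab_valid hw hp (by omega) hr (hne r hr s hs) (hslab r hr s hs).1 c' hc'
    exact ⟨h1, h2, h3, lt_of_le_of_lt (hwin r hr s hs).1 h4, h5.trans (hwin r hr s hs).2, h6⟩
  · -- distinct based pairs
    unfold slabData
    rw [List.map_flatMap]
    refine List.nodup_flatMap.mpr ⟨fun r hr => ?_, ?_⟩
    · rw [List.mem_range] at hr
      rw [List.map_flatMap]
      refine List.nodup_flatMap.mpr ⟨fun s hs => ?_, ?_⟩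
      · rw [List.mem_range] at hs
        exact slab_nodup (hslab r hr s (by omega)).2.1
      · refine List.pairwise_lt_range.imp_of_mem fun {s s'} hs hs' hss' => ?_
        rw [List.mem_range] at hs hs'
        intro q hq hq'
        simp only at hq hq'
        obtain ⟨c, hc, hcq⟩ := List.mem_map.mp hq
        obtain ⟨c', hc', hcq'⟩ := List.mem_map.mp hq'
        obtain ⟨d, hd, rfl⟩ := List.mem_map.mp hc
        obtain ⟨d', hd', rfl⟩ := List.mem_map.mp hc'
        obtain ⟨H1, -, -⟩ := slabAcc_sound w P9 E r hw (by omega) _ _ (t0 r s) (cs r s) (T r s) (hslab r hr s (by omega)).1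
        obtain ⟨H1', -, -⟩ := slabAcc_sound w P9 E r hw (by omega) _ _ (t0 r s') (cs r s') (T r s') (hslab r hr s' (by omega)).1
        have ha := (H1 d hd).2.1
        have hb := (H1' d' hd').1
        rw [← n9W_decodeChord_fst hp, hcq] at ha
        rw [← n9W_decodeChord_fst hp, hcq'] at hb
        have hmono := getD_mono_of_sorted (hcuts r hr).2.1 (Nat.succ_le_of_lt hss') (by omega : s' < (cuts r).length)
        have : (((cuts r).getD (s + 1) 0 : ℕ) : ℤ) ≤ ((cuts r).getD s' 0 : ℕ) := by exact_mod_cast hmono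
        exact absurd (ha.trans this) (not_le.mpr hb)
    · refine List.pairwise_lt_range.imp_of_mem fun {r r'} hr hr' hrr' => ?_
      intro q hq hq'
      simp only at hq hq'
      obtain ⟨c, hc, hcq⟩ := List.mem_map.mp hq
      obtain ⟨c', hc', hcq'⟩ := List.mem_map.mp hq'
      obtain ⟨s, -, hc⟩ := List.mem_flatMap.mp hc
      obtain ⟨s', -, hc'⟩ := List.mem_flatMap.mp hc'
      obtain ⟨d, -, rfl⟩ := List.mem_map.mp hc
      obtain ⟨d', -, rfl⟩ := List.mem_map.mp hc'
      have h1 : q.1.2 = (r : ℤ) := by rw [← hcq]; rfl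
      have h2 : q.1.2 = (r' : ℤ) := by rw [← hcq']; rfl
      omega
  · -- completeness
    set r := x.1.2.toNat with hrdef
    have hrz : (r : ℤ) = x.1.2 := Int.toNat_of_nonneg hxm
    have hr : r < w.length := by
      have : (r : ℤ) < ((wordZ w).length : ℤ) := by rw [hrz]; exact hxp
      rw [length_wordZ] at this; exact_mod_cast this
    have hx : x = (((0 : Cell 2), (r : ℤ)), x.2) := Prod.ext (Prod.ext hx0 hrz.symm) rfl
    obtain ⟨hlen, hsort, h0, hL⟩ := hcuts r hr
    rw [hx] at hxlo hxhi
    have hxMB' : |x.2.2 - (r : ℤ)| ≤ MB := by rw [hrz]; exact hxMB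
    obtain ⟨s, hs, c, hc, hcx⟩ := residue_completeW hw2 hp (by omega) hMB hlen hsort (by rw [hL]; exact hGBz)
      (fun s hs => (hslab r hr s hs).1) (fun s hs => (hslab r hr s hs).2.1) (fun s hs => (hslab r hr s hs).2.2.1)
      (fun s hs => (hslab r hr s hs).2.2.2) x.2 hxMB' (by rw [h0]; exact hxlo) (by rw [hL]; exact hxhi)
    refine ⟨decodeChord r c, ?_, by rw [hcx, ← hx]⟩
    unfold slabData
    refine List.mem_flatMap.mpr ⟨r, List.mem_range.mpr hr, List.mem_flatMap.mpr ⟨s, List.mem_range.mpr (by omega), ?_⟩⟩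
    exact List.mem_map.mpr ⟨c, hc, rfl⟩
  · -- tables
    have hpow : (0 : ℝ) < 2 ^ E := by positivity
    obtain ⟨hR, hN⟩ := theta_flatMap_range (wordZ w)
      (fun r => (List.range ((cuts r).length - 1)).flatMap fun s => (cs r s).map (decodeChord r)) k w.length
    have hRs := fun r => (theta_flatMap_range (wordZ w) (fun s => (cs r s).map (decodeChord r)) k ((cuts r).length - 1)).1
    have hNs := fun r => (theta_flatMap_range (wordZ w) (fun s => (cs r s).map (decodeChord r)) k ((cuts r).length - 1)).2
    unfold slabData slabTR slabTN
    constructor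
    · rw [hR]
      push_cast
      rw [Finset.sum_div]
      refine Finset.sum_le_sum fun r hr => ?_
      rw [Finset.mem_range] at hr
      rw [hRs r, Finset.sum_div]
      refine Finset.sum_le_sum fun s hs => ?_
      rw [Finset.mem_range] at hs
      exact slab_thetaR0_le hw hp (by omega) hP9 (by positivity) (hne r hr s (by omega)) (hslab r hr s (by omega)).1 k
    · rw [hN]
      push_cast
      rw [Finset.sum_div]
      refine Finset.sum_le_sum fun r hr => ?_
      rw [Finset.mem_range] at hr
      rw [hNs r, Finset.sum_div]
      refine Finset.sum_le_sum fun s hs => ?_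
      rw [Finset.mem_range] at hs
      exact slab_thetaN0_le hw hp (by omega) hP9 (by positivity) (hne r hr s (by omega)) (hslab r hr s (by omega)).1 k


/-! ### one residue (the window type's own centre) -/

/-- decoded chord data of ONE residue `r`: slabs `s < |cuts| − 1`. -/
def residueData (r : ℕ) (cuts : List ℕ) (cs : ℕ → List (List ℕ)) : List ChordDatum :=
  (List.range (cuts.length - 1)).flatMap fun s => (cs s).map (decodeChord r)

/-- the summed integer R table of one residue at the signed key `k`. -/
def residueTR (cuts : List ℕ) (T : ℕ → List (ℕ × ℕ × ℕ)) (k : ℤ × ℤ × ℤ × ℤ) : ℤ :=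
  ∑ s ∈ Finset.range (cuts.length - 1), (tabR (T s) (codeK k) : ℤ)

/-- the summed integer N table of one residue at the signed key `k`. -/
def residueTN (cuts : List ℕ) (T : ℕ → List (ℕ × ℕ × ℕ)) (k : ℤ × ℤ × ℤ × ℤ) : ℤ :=
  ∑ s ∈ Finset.range (cuts.length - 1), (tabN (T s) (codeK k) : ℤ)

/-- ★★★ THE ASSEMBLY FOR ONE WINDOW CENTRE (the shape a window type ω needs: `w := win ++ [0]`, `r := H₀`, `MB := H₀`): one residue `r < |w|`,
a sorted cut list from `lo` to `hi`, one certified slab + count per window with the chords' far layers within `MB`; conclusion = validity,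
distinctness, COMPLETENESS FOR BASED PAIRS AT LAYER `r` IN THE LAYER WINDOW, and the two table inequalities, for the data of this residue
alone. [folklore] -/
theorem kernelSlabSoundW_of_residue (w : List ℕ) (P9 E r GB MB lo hi : ℕ) (cuts : List ℕ) (t0 : ℕ → PT) (cs : ℕ → List (List ℕ))
    (T : ℕ → List (ℕ × ℕ × ℕ)) (hw2 : ∀ n ∈ w, n ≤ 2) (hp : w.length ∣ 612) (hr : r < w.length) (hr1 : r < 601) (hP9 : P9 ≤ 2000000)
    (hMB : MB ≤ 600) (hhi : hi < 2160000) (hGB : 4 * hi < 3 * (3 * GB + 1) ^ 2)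
    (hlen : 2 ≤ cuts.length) (hsort : cuts.Pairwise (· < ·)) (hc0 : cuts.getD 0 0 = lo) (hcL : cuts.getD (cuts.length - 1) 0 = hi)
    (hslab : ∀ s, s + 1 < cuts.length → slabAcc w P9 E r (cuts.getD s 0) (cuts.getD (s + 1) 0) (t0 s) (cs s) = some (T s) ∧
      lastCodesStrict (cs s) = true ∧ (cs s).length = (countWins w r GB MB cuts).getD s 0 ∧ layersWithin r MB (cs s) = true) :
    (∀ c ∈ residueData r cuts cs, c.1.1.1 = 0 ∧ 0 ≤ c.1.1.2 ∧ c.1.1.2 < ((wordZ w).length : ℤ) ∧ (lo : ℤ) < n9W (wordZ w) c.1 ∧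
        n9W (wordZ w) c.1 ≤ hi ∧ ∀ i < chordNp c, 0 < n9W (wordZ w) (chordPiece c i) ∧ n9W (wordZ w) (chordPiece c i) ≤ P9) ∧
      ((residueData r cuts cs).map (·.1)).Nodup ∧
      (∀ y : Cell 2 × ℤ, |y.2 - r| ≤ MB → (lo : ℤ) < n9W (wordZ w) (((0 : Cell 2), (r : ℤ)), y) →
        n9W (wordZ w) (((0 : Cell 2), (r : ℤ)), y) ≤ hi → ∃ c ∈ residueData r cuts cs, c.1 = (((0 : Cell 2), (r : ℤ)), y)) ∧
      ∀ k, thetaR0 (wordZ w) (residueData r cuts cs) k ≤ (residueTR cuts T k : ℝ) / 2 ^ E ∧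
        thetaN0 (wordZ w) (residueData r cuts cs) k ≤ (residueTN cuts T k : ℝ) / 2 ^ E := by
  have hw := regN_le_two hw2 w.length
  have hGBz : 4 * (hi : ℤ) < 3 * (3 * (GB : ℤ) + 1) ^ 2 := by exact_mod_cast hGB
  have hwin : ∀ s, s + 1 < cuts.length → (lo : ℤ) ≤ (cuts.getD s 0 : ℤ) ∧ ((cuts.getD (s + 1) 0 : ℕ) : ℤ) ≤ (hi : ℤ) := by
    intro s hs
    constructor
    · rw [← hc0]; exact_mod_cast getD_mono_of_sorted hsort (Nat.zero_le s) (by omega)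
    · rw [← hcL]; exact_mod_cast getD_mono_of_sorted hsort (by omega) (by omega)
  have hne : ∀ s, s + 1 < cuts.length → ∀ c ∈ cs s, c ≠ [] := by
    intro s hs c hc
    obtain ⟨H1, -, -⟩ := slabAcc_sound w P9 E r hw hr1 _ _ (t0 s) (cs s) (T s) (hslab s hs).1
    have hhi' : ((cuts.getD (s + 1) 0 : ℕ) : ℤ) < 2160000 := lt_of_le_of_lt (hwin s hs).2 (by exact_mod_cast hhi)
    exact ne_nil_of_window hhi' (H1 c hc).2.1
  have hmem : ∀ c' ∈ residueData r cuts cs, ∃ s, s + 1 < cuts.length ∧ c' ∈ (cs s).map (decodeChord r) := by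
    intro c' hc'
    unfold residueData at hc'
    obtain ⟨s, hs, hc'⟩ := List.mem_flatMap.mp hc'
    rw [List.mem_range] at hs
    exact ⟨s, by omega, hc'⟩
  refine ⟨fun c' hc' => ?_, ?_, fun y hyMB hylo hyhi => ?_, fun k => ?_⟩
  · obtain ⟨s, hs, hc'⟩ := hmem c' hc'
    obtain ⟨h1, h2, h3, h4, h5, h6⟩ := slab_valid hw hp hr1 hr (hne s hs) (hslab s hs).1 c' hc'
    exact ⟨h1, h2, h3, lt_of_le_of_lt (hwin s hs).1 h4, h5.trans (hwin s hs).2, h6⟩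
  · unfold residueData
    rw [List.map_flatMap]
    refine List.nodup_flatMap.mpr ⟨fun s hs => ?_, ?_⟩
    · rw [List.mem_range] at hs
      exact slab_nodup (hslab s (by omega)).2.1
    · refine List.pairwise_lt_range.imp_of_mem fun {s s'} hs hs' hss' => ?_
      rw [List.mem_range] at hs hs'
      intro q hq hq'
      simp only at hq hq'
      obtain ⟨c, hc, hcq⟩ := List.mem_map.mp hq
      obtain ⟨c', hc', hcq'⟩ := List.mem_map.mp hq'
      obtain ⟨d, hd, rfl⟩ := List.mem_map.mp hc
      obtain ⟨d', hd', rfl⟩ := List.mem_map.mp hc'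
      obtain ⟨H1, -, -⟩ := slabAcc_sound w P9 E r hw hr1 _ _ (t0 s) (cs s) (T s) (hslab s (by omega)).1
      obtain ⟨H1', -, -⟩ := slabAcc_sound w P9 E r hw hr1 _ _ (t0 s') (cs s') (T s') (hslab s' (by omega)).1
      have ha := (H1 d hd).2.1
      have hb := (H1' d' hd').1
      rw [← n9W_decodeChord_fst hp, hcq] at ha
      rw [← n9W_decodeChord_fst hp, hcq'] at hb
      have hmono := getD_mono_of_sorted hsort (Nat.succ_le_of_lt hss') (by omega : s' < cuts.length)
      have : ((cuts.getD (s + 1) 0 : ℕ) : ℤ) ≤ (cuts.getD s' 0 : ℕ) := by exact_mod_cast hmono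
      exact absurd (ha.trans this) (not_le.mpr hb)
  · obtain ⟨s, hs, c, hc, hcx⟩ := residue_completeW hw2 hp hr1 hMB hlen hsort (by rw [hcL]; exact hGBz)
      (fun s hs => (hslab s hs).1) (fun s hs => (hslab s hs).2.1) (fun s hs => (hslab s hs).2.2.1) (fun s hs => (hslab s hs).2.2.2)
      y hyMB (by rw [hc0]; exact hylo) (by rw [hcL]; exact hyhi)
    refine ⟨decodeChord r c, ?_, hcx⟩
    unfold residueData
    exact List.mem_flatMap.mpr ⟨s, List.mem_range.mpr (by omega), List.mem_map.mpr ⟨c, hc, rfl⟩⟩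
  · have hpow : (0 : ℝ) < 2 ^ E := by positivity
    obtain ⟨hR, hN⟩ := theta_flatMap_range (wordZ w) (fun s => (cs s).map (decodeChord r)) k (cuts.length - 1)
    unfold residueData residueTR residueTN
    constructor
    · rw [hR]
      push_cast
      rw [Finset.sum_div]
      refine Finset.sum_le_sum fun s hs => ?_
      rw [Finset.mem_range] at hs
      exact slab_thetaR0_le hw hp hr1 hP9 (by positivity) (hne s (by omega)) (hslab s (by omega)).1 k
    · rw [hN]
      push_cast
      rw [Finset.sum_div]
      refine Finset.sum_le_sum fun s hs => ?_
      rw [Finset.mem_range] at hs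
      exact slab_thetaN0_le hw hp hr1 hP9 (by positivity) (hne s (by omega)) (hslab s (by omega)).1 k

end Summit.AtomisticToContinuum.Crystallization.Theorems.ChartedZeroExcessLayeredLatticeLiouville.ThetaKernel
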